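import Summits.BirchSwinnertonDyer.BirchSwinnertonDyer.Theorems.GenusKolyvaginAtTwoPowDvdShaCardAtTwoRTPrimeLevelRung
import Summits.BirchSwinnertonDyer.BirchSwinnertonDyer.Theorems.GenusKolyvaginAtTwoPowDvdShaCardAtTwoRTEigenRung
import HarnessLib

/-!
# Route `GenusKolyvaginAtTwo`, LINE 18 `plus_descent` on L_T `PowDvdShaCardAtTwoRT` (stmt-BirchSwinnertonDyer-23242), stub 3a⁗ —
# THE PRIME-LEVEL RANK-ZERO READING for root number `w(E) = −1`: the rank-zero member is the TWIN `E^{(d_K)}`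

Seat `bsd-line-gk2-p1` g14 (LEAD seat 1/3, cell `bsd-f1-sign2`), `--supports stmt-BirchSwinnertonDyer-23242 --as helper`; mirror of
`…RTPrimeLevelRung` (`w(E) = +1`).  THEOREMS ONLY (no definition, no named fact, no `sorry`).  Nothing here closes an item; BSD is not
proved by any of this.

The frames of L_T / L⁺_T do not fix the root number of `E`; for `w(E) = −1` the Heegner point lies on the `E`-side, the twin `E^{(d_K)}` has
rank `0`, and the odd-depth Kolyvagin classes are `τ`-ANTI-invariant (gk2-p3 `KolyvaginClassSign.sign_conjAct_kolyvaginClass_two`: sign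
`−w(E)·(−1) = w(E) = −1`), hence descend to `H¹(ℚ, E^{(d_K)}[2^M])` (gk2-p3 `EigenClassesFinite.existsUnique_hPsiKT_resTorsion_eq_of_conjAct_eq_neg`)
where the one-bit rung of `…RTEigenRung` applies:

* `two_mul_sub_one_le_padicValNat_sha_twist_of_primitive_prime_level` — frame (`W` globally minimal, `ρ̄_{E,2}` onto, `w(E) = −1`; `K`
  imaginary quadratic with odd `d_K ≠ −3`, Heegner; the twin `E^{(d_K)} = W.quadraticTwist d_K` of rank `0` with odd torsion and finite
  `Ш[2^∞]`), `ℓ` a Kolyvagin prime of index `≥ M ≥ 1`, data at the divisors of `ℓ`, **`P(ℓ) ∉ 2E(K[ℓ])`** and **`c_M(ℓ) ∈ Sel^{(2^M)}(E_K/K)`**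
  ⟹ **`2(M − 1) ≤ ord₂ #Ш(E^{(d_K)}/ℚ)[2^∞]`**;
* `…_of_odd_tamagawaProduct` — the Selmer input reduced to the places above `ℓ` (fkl-p1's Lemma 4.3 at `2`, complex places free).

References: [McCallumLMS1991] §4 Lemma 4.3, Cor. 4.5, §5 p. 310; [GrossLMS1991] Prop. 5.4, §5 (5.1), Prop. 6.2 (1); [Kolyvagin1989Izv] §3.
-/

set_option autoImplicit false
-- the Theorems namespace of this sub repeats the summit name by design (D-0017 nested layout)
set_option linter.dupNamespace false

noncomputable section

open scoped Classical

namespace Summit.BirchSwinnertonDyer.BirchSwinnertonDyer.Theorems.GenusExact.PlusDescent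

open NumberField WeierstrassCurve Field Literature.NumberTheory.EllipticCurves
  Literature.NumberTheory.EllipticCurves.ModularForms IsDedekindDomain

variable {W : WeierstrassCurve ℚ} [NeZero (W.conductorNorm ℤ)] {K : Type} [Field K] [NumberField K]
  {Dt : ModularParametrizationData W (W.conductorNorm ℤ)} {β : ℤ} {ι : K →+* ℂ}

/-- **THE PRIME-LEVEL RANK-ZERO READING of 3a⁗ for `w(E) = −1` (twin side).**  `W/ℚ` globally minimal with `ρ̄_{E,2}` onto and root
number `−1`; `K` imaginary quadratic with odd `d_K ≠ −3` and the Heegner hypothesis; the twin `E^{(d_K)}` (`W.quadraticTwist d_K`) of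
rank `0` with odd torsion and finite `Ш[2^∞]`; `ℓ` a Kolyvagin prime at `2` with `1 ≤ M ≤ M(ℓ)`; data at the divisors of `ℓ` with `P(ℓ)`
`2`-PRIMITIVE and `c_M(ℓ)` SELMER over `K`.  Then `2(M − 1) ≤ ord₂ #Ш(E^{(d_K)}/ℚ)[2^∞]`: `ord c_M(ℓ) = 2^M`
(`addOrderOf_kolyvaginClass_two_eq_pow_of_not_two_dvd`), `σ₀·c_M(ℓ) = −c_M(ℓ)` (sign `w(E) = −1`), then
`two_mul_sub_one_le_padicValNat_sha_twist_of_antiInvariant_selmer_class`.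
[cite: McCallumLMS1991, §4 Cor. 4.5 and §5 p. 310] [cite: GrossLMS1991, Prop. 5.4 and §5 (5.1)] [cite: Kolyvagin1989Izv, §3] -/
theorem two_mul_sub_one_le_padicValNat_sha_twist_of_primitive_prime_level [W.IsElliptic] [W.IsGloballyMinimal]
    (hK : IsImaginaryQuadratic K) (hodd : Odd (NumberField.discr K)) (h3 : NumberField.discr K ≠ -3)
    (hH : SatisfiesHeegnerHypothesis (W.conductorNorm ℤ) K) (hsurj : W.HasSurjectiveModNGaloisRep ((2 : ℤ) ^ 1))
    (hw : W.rootNumber = -1)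
    (hrk : (W.quadraticTwist ((NumberField.discr K : ℤ) : ℚ)).mordellWeilRank = 0)
    (htor : Odd (W.quadraticTwist ((NumberField.discr K : ℤ) : ℚ)).torsionOrder)
    [Finite (AddCommGroup.primaryComponent (W.quadraticTwist ((NumberField.discr K : ℤ) : ℚ)).sha 2)]
    {ℓ M : ℕ} (hℓ : ℓ.Prime) (hM : 1 ≤ M)
    (hkol : Zhang2014.IsKolyvaginPrime (W.conductorNorm ℤ) W K 2 ℓ ∧ M ≤ Zhang2014.kolyvaginIndex W 2 ℓ)
    (d : (m : ℕ) → m ∣ ℓ → KolyvaginHeegnerData Dt β ι m)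
    (hprim : ¬ ∃ Q : (W.baseChange (ringClassField K ι ℓ)).toAffine.Point, (2 : ℤ) • Q = (d ℓ dvd_rfl).derivedPoint)
    (hsel : (d ℓ dvd_rfl).kolyvaginClass Nat.prime_two M ∈ selmerGroup (W.baseChange K) ((2 ^ M : ℕ) : ℤ)) :
    2 * (M - 1) ≤ padicValNat 2
      (Nat.card (AddCommGroup.primaryComponent (W.quadraticTwist ((NumberField.discr K : ℤ) : ℚ)).sha 2)) := by
  have hsq : Squarefree ℓ := hℓ.squarefree
  have hkol' : ∀ q ∈ ℓ.primeFactors,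
      Zhang2014.IsKolyvaginPrime (W.conductorNorm ℤ) W K 2 q ∧ M ≤ Zhang2014.kolyvaginIndex W 2 q := by
    intro q hq
    rw [hℓ.primeFactors, Finset.mem_singleton] at hq
    subst hq
    exact hkol
  have hD4 : NumberField.discr K ≠ -4 := by
    intro h
    rw [h] at hodd
    exact (Int.not_even_iff_odd.mpr hodd) ⟨-2, by norm_num⟩
  have hd0 : ((NumberField.discr K : ℤ) : ℚ) ≠ 0 := by exact_mod_cast NumberField.discr_ne_zero K
  obtain ⟨θ, hθ, hθsq⟩ :=
    Literature.NumberTheory.QuadraticFields.Quadratic.exists_not_mem_range_sq_eq_discr (K := K) hK.1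
  have hτ : sigmaQ K hK.1 hθ hθsq ≠ 1 := sigmaQ_ne_one K hK.1 hθ hθsq
  -- order `2^M`
  have hord := addOrderOf_kolyvaginClass_two_eq_pow_of_not_two_dvd hK hodd h3 hH hsurj hsq hM hkol' d hprim
  -- anti-invariance from the sign `−w(E)·(−1)^{#primes of ℓ} = w(E) = −1`
  obtain ⟨-, hsign⟩ := KolyvaginClassSign.sign_conjAct_kolyvaginClass_two hK h3 hD4 hodd hH hsurj (sigmaQ K hK.1 hθ hθsq) hτ
    Dt β ι hsq hM hkol' (d ℓ dvd_rfl)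
  have hcard : ℓ.primeFactors.card = 1 := by rw [hℓ.primeFactors, Finset.card_singleton]
  rw [hcard, hw, pow_one, mul_neg_one, neg_neg, neg_one_zsmul] at hsign
  have hsurj2 : W.HasSurjectiveModNGaloisRep 2 := by simpa using hsurj
  exact two_mul_sub_one_le_padicValNat_sha_twist_of_antiInvariant_selmer_class W hK.1 hθ hθsq hd0 hsurj2 hrk htor M hsel
    hsign hord

/-- **The same with the Selmer input reduced to the places above `ℓ`** (odd-Tamagawa habitat, `ρ_{E,2^k}` onto for every `k`):
McCallum's Lemma 4.3 over `K` at `2` off `ℓ` is fkl-p1's `RankOneAtTwoOneDoor.kolyvaginClass_two_mem_selmerLocalKer_of_odd_tamagawaProduct`,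
the complex places ask nothing. [cite: McCallumLMS1991, §4 Lemma 4.3 and §5 p. 310] [cite: GrossLMS1991, Prop. 6.2 (1)] -/
theorem two_mul_sub_one_le_padicValNat_sha_twist_of_primitive_prime_level_of_odd_tamagawaProduct [W.IsElliptic]
    [W.IsGloballyMinimal] (hK : IsImaginaryQuadratic K) (hodd : Odd (NumberField.discr K)) (h3 : NumberField.discr K ≠ -3)
    (hH : SatisfiesHeegnerHypothesis (W.conductorNorm ℤ) K) (hsurj : ∀ k : ℕ, W.HasSurjectiveModNGaloisRep ((2 ^ k : ℕ) : ℤ))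
    (hT : Odd W.tamagawaProduct) (hw : W.rootNumber = -1)
    (hrk : (W.quadraticTwist ((NumberField.discr K : ℤ) : ℚ)).mordellWeilRank = 0)
    (htor : Odd (W.quadraticTwist ((NumberField.discr K : ℤ) : ℚ)).torsionOrder)
    [Finite (AddCommGroup.primaryComponent (W.quadraticTwist ((NumberField.discr K : ℤ) : ℚ)).sha 2)]
    {ℓ M : ℕ} (hℓ : ℓ.Prime) (hM : 1 ≤ M)
    (hkol : Zhang2014.IsKolyvaginPrime (W.conductorNorm ℤ) W K 2 ℓ ∧ M ≤ Zhang2014.kolyvaginIndex W 2 ℓ)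
    (d : (m : ℕ) → m ∣ ℓ → KolyvaginHeegnerData Dt β ι m)
    (hprim : ¬ ∃ Q : (W.baseChange (ringClassField K ι ℓ)).toAffine.Point, (2 : ℤ) • Q = (d ℓ dvd_rfl).derivedPoint)
    (hselℓ : ∀ w : HeightOneSpectrum (𝓞 K), (ℓ : 𝓞 K) ∈ w.asIdeal →
      (d ℓ dvd_rfl).kolyvaginClass Nat.prime_two M ∈ selmerLocalKer (W.baseChange K) (w.adicCompletion K) ((2 ^ M : ℕ) : ℤ)) :
    2 * (M - 1) ≤ padicValNat 2
      (Nat.card (AddCommGroup.primaryComponent (W.quadraticTwist ((NumberField.discr K : ℤ) : ℚ)).sha 2)) := by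
  have hsq : Squarefree ℓ := hℓ.squarefree
  have hkol' : ∀ q ∈ ℓ.primeFactors,
      Zhang2014.IsKolyvaginPrime (W.conductorNorm ℤ) W K 2 q ∧ M ≤ Zhang2014.kolyvaginIndex W 2 q := by
    intro q hq
    rw [hℓ.primeFactors, Finset.mem_singleton] at hq
    subst hq
    exact hkol
  have hD4 : NumberField.discr K ≠ -4 := by
    intro h
    rw [h] at hodd
    exact (Int.not_even_iff_odd.mpr hodd) ⟨-2, by norm_num⟩
  have hsurj1 : W.HasSurjectiveModNGaloisRep ((2 : ℤ) ^ 1) := by simpa using hsurj 1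
  have hsel : (d ℓ dvd_rfl).kolyvaginClass Nat.prime_two M ∈ selmerGroup (W.baseChange K) ((2 ^ M : ℕ) : ℤ) := by
    rw [mem_selmerGroup_iff]
    refine ⟨fun w ↦ ?_, fun w ↦ mem_selmerLocalKer_infinitePlace_of_isImaginaryQuadratic hK _ w _⟩
    by_cases hw' : (ℓ : 𝓞 K) ∈ w.asIdeal
    · exact hselℓ w hw'
    · exact RankOneAtTwoOneDoor.kolyvaginClass_two_mem_selmerLocalKer_of_odd_tamagawaProduct W hsurj hT K hK h3 hD4 hH
        Dt β ι M hsq hkol' (d ℓ dvd_rfl) w hw'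
  exact two_mul_sub_one_le_padicValNat_sha_twist_of_primitive_prime_level hK hodd h3 hH hsurj1 hw hrk htor hℓ hM hkol d
    hprim hsel

end Summit.BirchSwinnertonDyer.BirchSwinnertonDyer.Theorems.GenusExact.PlusDescent

end
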